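import Summits.QuantumFields.QCD.Theorems.QuarksAsStableActionStableActionBridgeSliceNilpotent

/-!
# Transport of a similarity through the time-ordered product of the fermion determinant
(helper for crux stmt-QuantumFields-9737 `QuarksAsStableAction.StableActionBridge`, line `Sketch` —
stubs `det_one_sub_prod_conj` and `sliceKron_one_mul_sliceGaugeRot_comm`)

In the transfer-matrix form of the Wilson fermion determinant,
`det D_W = c · det (1 − ∏_t M_t W_t)` (time-ordered product of the one-step matrices `M_t` and the
temporal transporters `W_t`), the one-step matrix of the Wilson-determinant transfer form and
Smit's one-particle fermionic transfer matrix `M_F(U_t)` (Smit, *Introduction to Quantum Fields on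
a Lattice*, §6.5 (6.84)–(6.91); Lüscher 1977) are similar by a *spin-only* matrix,
`M_t = V M_F(U_t) V⁻¹` with `V = 1 ⊗ γ₀γ₅`.  The temporal transporters `W_t = G_t` are gauge
rotations of the slice quark modes, hence *spin-blind* (`sliceGaugeRot g = R_c ⊗ 1`), so they
commute with `V`; the conjugations then telescope through the product,
`∏_t (V X_t V⁻¹ G_t) = V (∏_t X_t G_t) V⁻¹`, and `det (1 − V Q V⁻¹) = det (V (1 − Q) V⁻¹) = det (1 − Q)`.

This file records the two registered atoms of this step:

* `det_one_sub_prod_conj` — the pure matrix algebra: for `V' V = 1 = V V'` and `G_i V = V G_i`,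
  `det (1 − ∏_{i<L} V X_i V' G_i) = det (1 − ∏_{i<L} X_i G_i)` (induction on `L` via
  `List.range_succ`; then `Matrix.det_mul_right_comm`);
* `sliceKron_one_mul_sliceGaugeRot_comm` — a spin-only matrix `1 ⊗ Γ` commutes with the gauge
  rotation `sliceGaugeRot g = R_c ⊗ 1` (the landed `sliceKron` toolkit,
  `SliceNilpotent.sliceKron_mul`).

The reusable pieces (commutation with the inverse, the telescoping product identity, the
conjugated `1 − Q`) are exported in the sub-namespace `ConjTransport`, stated in an arbitrary
monoid / ring.  Pure theorem file (no definitions).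

[cite: Smit2023, §6.5 (6.84)–(6.91)]
-/

noncomputable section

namespace Summit.QuantumFields.QCD.Cruxes.StableActionBridge.Sketch

open MeasureTheory Matrix Literature.MathematicalPhysics.QuantumFieldTheory
  Literature.MathematicalPhysics.QuantumLattice
open Literature.Probability.LatticeModels (TorusSite)

namespace ConjTransport

/-! ### Monoid / ring algebra of the conjugation `X ↦ V X V'` -/

/-- If `G` commutes with `V` and `V'` is a two-sided inverse of `V`, then `G` commutes with `V'`:
`V' G = G V'`. [folklore] -/
theorem inv_mul_comm_of_mul_comm {R : Type*} [Monoid R] {V V' G : R} (hV'V : V' * V = 1)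
    (hVV' : V * V' = 1) (hG : G * V = V * G) : V' * G = G * V' := by
  calc V' * G = V' * G * (V * V') := by rw [hVV', mul_one]
    _ = V' * (G * V) * V' := by rw [← mul_assoc, mul_assoc V' G V]
    _ = V' * V * G * V' := by rw [hG, ← mul_assoc]
    _ = G * V' := by rw [hV'V, one_mul]

/-- **Telescoping of conjugations through an ordered product.**  If `V' V = 1 = V V'` and every
`G i` commutes with `V`, then
`∏_{i<L} (V X_i V' G_i) = V (∏_{i<L} X_i G_i) V'` (ordered `List` product over `List.range L`).
[folklore] -/
theorem prod_map_conj_mul {R : Type*} [Monoid R] (V V' : R) (X G : ℕ → R) (hV'V : V' * V = 1)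
    (hVV' : V * V' = 1) (hG : ∀ i, G i * V = V * G i) :
    ∀ L : ℕ, ((List.range L).map fun i => V * X i * V' * G i).prod =
      V * ((List.range L).map fun i => X i * G i).prod * V'
  | 0 => by rw [List.range_zero, List.map_nil, List.map_nil, List.prod_nil, mul_one, hVV']
  | L + 1 => by
    rw [List.range_succ, List.map_append, List.map_append, List.prod_append, List.prod_append,
      List.map_singleton, List.map_singleton, List.prod_singleton, List.prod_singleton,
      prod_map_conj_mul V V' X G hV'V hVV' hG L]
    -- `(V P V') (V X V' G) = V P (V' V) X (V' G) = V (P (X G)) V'`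
    set P := ((List.range L).map fun i => X i * G i).prod
    calc V * P * V' * (V * X L * V' * G L)
        = V * P * (V' * V) * X L * (V' * G L) := by simp only [mul_assoc]
      _ = V * (P * (X L * G L)) * V' := by
          rw [hV'V, mul_one, inv_mul_comm_of_mul_comm hV'V hVV' (hG L)]
          simp only [mul_assoc]

/-- `1 − V Q V' = V (1 − Q) V'` when `V V' = 1`. [folklore] -/
theorem one_sub_conj {R : Type*} [Ring R] (V V' Q : R) (hVV' : V * V' = 1) :
    1 - V * Q * V' = V * (1 - Q) * V' := by
  rw [mul_sub, sub_mul, mul_one, hVV']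

/-- `det (V P V') = det P` when `V V' = 1` (`det (V P V') = det (V V' P)`). [folklore] -/
theorem det_conj_of_mul_eq_one {n : Type*} [Fintype n] [DecidableEq n] {R : Type*} [CommRing R]
    (V V' P : Matrix n n R) (hVV' : V * V' = 1) : (V * P * V').det = P.det := by
  rw [Matrix.det_mul_right_comm, hVV', Matrix.one_mul]

end ConjTransport

/-- **Stub `det_one_sub_prod_conj` of line `Sketch`.**  Transport of a similarity `X_i ↦ V X_i V'`
(`V' V = 1 = V V'`) through the time-ordered product of `det (1 − ∏_i M_i G_i)` when the
transporters `G_i` commute with `V`: the conjugations telescope,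
`∏_{i<L} (V X_i V' G_i) = V (∏_{i<L} X_i G_i) V'`, and
`det (1 − V Q V') = det (V (1 − Q) V') = det (1 − Q)`. [folklore] -/
theorem det_one_sub_prod_conj : ∀ (n : Type) [Fintype n] [DecidableEq n] (V V' : Matrix n n ℂ) (X G : ℕ → Matrix n n ℂ) (L : ℕ), V' * V = 1 → V * V' = 1 → (∀ i, G i * V = V * G i) → (1 - ((List.range L).map fun i => V * X i * V' * G i).prod).det = (1 - ((List.range L).map fun i => X i * G i).prod).det := by
  intro n _ _ V V' X G L hV'V hVV' hG
  rw [ConjTransport.prod_map_conj_mul V V' X G hV'V hVV' hG L, ConjTransport.one_sub_conj _ _ _ hVV',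
    ConjTransport.det_conj_of_mul_eq_one _ _ _ hVV']

/-- **Stub `sliceKron_one_mul_sliceGaugeRot_comm` of line `Sketch`.**  A spin-only matrix `1 ⊗ Γ`
on the slice quark modes commutes with the (spin-blind) one-particle gauge rotation
`sliceGaugeRot g = R_c ⊗ 1` (Smit §4.6 (4.124)–(4.126)):
`(1 ⊗ Γ)(R_c ⊗ 1) = R_c ⊗ Γ = (R_c ⊗ 1)(1 ⊗ Γ)`. [cite: Smit2023, §4.6 (4.124)–(4.126)] -/
theorem sliceKron_one_mul_sliceGaugeRot_comm : ∀ (Nf S : ℕ) [NeZero S] (Γ : Matrix (Fin 4) (Fin 4) ℂ) (g : Literature.Probability.LatticeModels.TorusSite 3 S → Matrix.specialUnitaryGroup (Fin 3) ℂ), sliceKron (Nf := Nf) (S := S) 1 Γ * sliceGaugeRot g = sliceGaugeRot g * sliceKron 1 Γ := by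
  intro Nf S _ Γ g
  rw [sliceGaugeRot, SliceNilpotent.sliceKron_mul, SliceNilpotent.sliceKron_mul, Matrix.one_mul,
    Matrix.mul_one, Matrix.one_mul, Matrix.mul_one]

end Summit.QuantumFields.QCD.Cruxes.StableActionBridge.Sketch

end
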